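import Summits.Ventures.PercRepro.C041ZoneOCubeCountCS
import Summits.Ventures.PercRepro.C041TreeClosure

/-!
# ROW C-041 — THE SIX-VECTOR of a zone with one anchor (p6, gen 29; mine-3's C-041.md §19 (i), §20 (b)–(c))

The six-vector `Π(Z) = (F, F + T₁, F + T₂, I_F, I_F + I₁, I_F + I₂)` of a zone with one anchor `k`, nothing protected:
`F` = the admissible states whose anchor sub-zone is all red, `F + T₁` = those with no blue `2`-mark on it (`FAset`),
`F + T₂` = those with no blue `1`-mark on it (`FBset`), and `I_F`, `I_F + I₁`, `I_F + I₂` the INVALID ones among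
them (`IFset`, `IAset`, `IBset`).  Its root 4-vector `ψ(Π) = (Π₀, Π₁ − Π₀, Π₂ − Π₀, Π₄ + Π₅ − Π₃)` is `(F, T₁, T₂, I)`
(`sixVec_zero` …, `card_Iset_eq_IA_add_IB_sub_IF`: an invalid admissible state is of exactly one of the three kinds),
so mine-3's cone membership `InCone (sixVec Z k)` (`C041TreeClosure`) gives the invariant (P) of the four counts
(`K4_of_inCone_sixVec`), hence the one-anchor (CS) and the ZONE O-CUBE (`zoneCSConj_of_inCone_sixVec`,
`zoneOCubeConj_of_inCone_sixVec`).  The six-vector is what multiplies over blocks at the anchor (the next module).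
-/

namespace PercRepro

namespace ZoneZ

namespace ZoneData

open Finset TreeClosure

variable {V E T₁ T₂ : Type*} (Z : ZoneData V E T₁ T₂) (k : V)
variable [Fintype E] [DecidableEq E] [Fintype T₁] [DecidableEq T₁] [Fintype T₂] [DecidableEq T₂]

open Classical in
/-- `F + T₁`: the admissible states whose anchor sub-zone carries no blue `2`-mark. -/
noncomputable def FAset : Finset (State E T₁ T₂) := univ.filter fun σ => Z.adm σ ∧ k ∉ Z.D2 σ

open Classical in
/-- `F + T₂`: the admissible states whose anchor sub-zone carries no blue `1`-mark. -/
noncomputable def FBset : Finset (State E T₁ T₂) := univ.filter fun σ => Z.adm σ ∧ k ∉ Z.D σ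

open Classical in
/-- `I_F`: the invalid admissible states whose anchor sub-zone is all red. -/
noncomputable def IFset : Finset (State E T₁ T₂) :=
  univ.filter fun σ => Z.adm σ ∧ Z.blueK {k} σ ∧ k ∉ Z.D σ ∧ k ∉ Z.D2 σ

open Classical in
/-- `I_F + I₁`: the invalid admissible states whose anchor sub-zone carries no blue `2`-mark. -/
noncomputable def IAset : Finset (State E T₁ T₂) := univ.filter fun σ => Z.adm σ ∧ Z.blueK {k} σ ∧ k ∉ Z.D2 σ

open Classical in
/-- `I_F + I₂`: the invalid admissible states whose anchor sub-zone carries no blue `1`-mark. -/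
noncomputable def IBset : Finset (State E T₁ T₂) := univ.filter fun σ => Z.adm σ ∧ Z.blueK {k} σ ∧ k ∉ Z.D σ

/-- Membership in `FAset`. -/
theorem mem_FAset {σ : State E T₁ T₂} : σ ∈ Z.FAset k ↔ Z.adm σ ∧ k ∉ Z.D2 σ := by
  classical
  unfold FAset
  rw [Finset.mem_filter]
  exact and_iff_right (Finset.mem_univ _)

/-- Membership in `FBset`. -/
theorem mem_FBset {σ : State E T₁ T₂} : σ ∈ Z.FBset k ↔ Z.adm σ ∧ k ∉ Z.D σ := by
  classical
  unfold FBset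
  rw [Finset.mem_filter]
  exact and_iff_right (Finset.mem_univ _)

/-- Membership in `IFset`. -/
theorem mem_IFset {σ : State E T₁ T₂} : σ ∈ Z.IFset k ↔ Z.adm σ ∧ Z.blueK {k} σ ∧ k ∉ Z.D σ ∧ k ∉ Z.D2 σ := by
  classical
  unfold IFset
  rw [Finset.mem_filter]
  exact and_iff_right (Finset.mem_univ _)

/-- Membership in `IAset`. -/
theorem mem_IAset {σ : State E T₁ T₂} : σ ∈ Z.IAset k ↔ Z.adm σ ∧ Z.blueK {k} σ ∧ k ∉ Z.D2 σ := by
  classical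
  unfold IAset
  rw [Finset.mem_filter]
  exact and_iff_right (Finset.mem_univ _)

/-- Membership in `IBset`. -/
theorem mem_IBset {σ : State E T₁ T₂} : σ ∈ Z.IBset k ↔ Z.adm σ ∧ Z.blueK {k} σ ∧ k ∉ Z.D σ := by
  classical
  unfold IBset
  rw [Finset.mem_filter]
  exact and_iff_right (Finset.mem_univ _)

/-- `#(F + T₁) = #F + #T₁`. -/
theorem card_FAset : #(Z.FAset k) = #(Z.Fset k) + #(Z.T1set k) := by
  classical
  have h := Finset.card_filter_add_card_filter_not (s := Z.FAset k) fun σ => k ∈ Z.D σ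
  have e1 : (Z.FAset k).filter (fun σ => k ∈ Z.D σ) = Z.T1set k := by
    ext σ
    rw [Finset.mem_filter, mem_FAset, mem_T1set]
    constructor
    · rintro ⟨⟨h1, -⟩, h2⟩
      exact ⟨h1, h2⟩
    · rintro ⟨h1, h2⟩
      exact ⟨⟨h1, Z.not_mem_D_of_mem_D2 k σ h1 |> fun h => fun h3 => h h3 h2⟩, h2⟩
  have e2 : (Z.FAset k).filter (fun σ => ¬ k ∈ Z.D σ) = Z.Fset k := by
    ext σ
    rw [Finset.mem_filter, mem_FAset, mem_Fset]
    tauto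
  rw [e1, e2] at h
  omega

/-- `#(F + T₂) = #F + #T₂`. -/
theorem card_FBset : #(Z.FBset k) = #(Z.Fset k) + #(Z.T2set k) := by
  classical
  have h := Finset.card_filter_add_card_filter_not (s := Z.FBset k) fun σ => k ∈ Z.D2 σ
  have e1 : (Z.FBset k).filter (fun σ => k ∈ Z.D2 σ) = Z.T2set k := by
    ext σ
    rw [Finset.mem_filter, mem_FBset, mem_T2set]
    constructor
    · rintro ⟨⟨h1, -⟩, h2⟩
      exact ⟨h1, h2⟩
    · rintro ⟨h1, h2⟩
      exact ⟨⟨h1, Z.not_mem_D_of_mem_D2 k σ h1 h2⟩, h2⟩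
  have e2 : (Z.FBset k).filter (fun σ => ¬ k ∈ Z.D2 σ) = Z.Fset k := by
    ext σ
    rw [Finset.mem_filter, mem_FBset, mem_Fset]
    tauto
  rw [e1, e2] at h
  omega

/-- The invalid admissible states: `#I + #I_F = #(I_F + I₁) + #(I_F + I₂)` (an admissible state is not of both
types). -/
theorem card_Iset_add_IFset : #(Z.Iset k) + #(Z.IFset k) = #(Z.IAset k) + #(Z.IBset k) := by
  classical
  have h1 := Finset.card_filter_add_card_filter_not (s := Z.Iset k) fun σ => k ∈ Z.D2 σ
  have h2 := Finset.card_filter_add_card_filter_not (s := Z.IBset k) fun σ => k ∈ Z.D2 σ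
  have e1 : (Z.Iset k).filter (fun σ => ¬ k ∈ Z.D2 σ) = Z.IAset k := by
    ext σ
    rw [Finset.mem_filter, mem_Iset, mem_IAset]
    tauto
  have e2 : (Z.Iset k).filter (fun σ => k ∈ Z.D2 σ) = (Z.IBset k).filter (fun σ => k ∈ Z.D2 σ) := by
    ext σ
    rw [Finset.mem_filter, Finset.mem_filter, mem_Iset, mem_IBset]
    constructor
    · rintro ⟨⟨h1, h2⟩, h3⟩
      exact ⟨⟨h1, h2, Z.not_mem_D_of_mem_D2 k σ h1 h3⟩, h3⟩
    · rintro ⟨⟨h1, h2, -⟩, h3⟩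
      exact ⟨⟨h1, h2⟩, h3⟩
  have e3 : (Z.IBset k).filter (fun σ => ¬ k ∈ Z.D2 σ) = Z.IFset k := by
    ext σ
    rw [Finset.mem_filter, mem_IBset, mem_IFset]
    tauto
  rw [e1, e2] at h1
  rw [e3] at h2
  omega

/-- **THE SIX-VECTOR** `(F, F + T₁, F + T₂, I_F, I_F + I₁, I_F + I₂)` of a zone with one anchor. -/
noncomputable def sixVec : Vec6 :=
  ![(#(Z.Fset k) : ℝ), #(Z.FAset k), #(Z.FBset k), #(Z.IFset k), #(Z.IAset k), #(Z.IBset k)]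

/-- The coordinates of the six-vector. -/
theorem sixVec_zero : Z.sixVec k 0 = #(Z.Fset k) := rfl
/-- The coordinates of the six-vector. -/
theorem sixVec_one : Z.sixVec k 1 = #(Z.FAset k) := rfl
/-- The coordinates of the six-vector. -/
theorem sixVec_two : Z.sixVec k 2 = #(Z.FBset k) := rfl
/-- The coordinates of the six-vector. -/
theorem sixVec_three : Z.sixVec k 3 = #(Z.IFset k) := rfl
/-- The coordinates of the six-vector. -/
theorem sixVec_four : Z.sixVec k 4 = #(Z.IAset k) := rfl
/-- The coordinates of the six-vector. -/
theorem sixVec_five : Z.sixVec k 5 = #(Z.IBset k) := rfl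

/-- **The root 4-vector of the six-vector is `(F, T₁, T₂, I)`**: `K4v (sixVec) ↔ K4 #F #T₁ #T₂ #I`. -/
theorem K4v_sixVec_iff :
    K4v (Z.sixVec k) ↔ K4 (#(Z.Fset k) : ℝ) (#(Z.T1set k)) (#(Z.T2set k)) (#(Z.Iset k)) := by
  unfold K4v
  rw [sixVec_zero, sixVec_one, sixVec_two, sixVec_three, sixVec_four, sixVec_five]
  have hA : (#(Z.FAset k) : ℝ) - #(Z.Fset k) = #(Z.T1set k) := by
    rw [card_FAset]
    push_cast
    ring
  have hB : (#(Z.FBset k) : ℝ) - #(Z.Fset k) = #(Z.T2set k) := by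
    rw [card_FBset]
    push_cast
    ring
  have hI : (#(Z.IAset k) : ℝ) + #(Z.IBset k) - #(Z.IFset k) = #(Z.Iset k) := by
    have h := Z.card_Iset_add_IFset k
    have h' : ((#(Z.Iset k) + #(Z.IFset k) : ℕ) : ℝ) = ((#(Z.IAset k) + #(Z.IBset k) : ℕ) : ℝ) := by rw [h]
    push_cast at h'
    linarith
  rw [hA, hB, hI]

/-- **Cone membership of the six-vector gives (P)** for the four counts. -/
theorem K4_of_inCone_sixVec (h : InCone (Z.sixVec k)) :
    K4 (#(Z.Fset k) : ℝ) (#(Z.T1set k)) (#(Z.T2set k)) (#(Z.Iset k)) :=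
  (Z.K4v_sixVec_iff k).1 (K4v_of_InCone h)

/-- Cone membership of the six-vector gives the one-anchor (CS). -/
theorem zoneCSConj_of_inCone_sixVec (h : InCone (Z.sixVec k)) : Z.ZoneCSConj {k} (∅ : Set V) := by
  have hK := Z.K4_of_inCone_sixVec k h
  rw [zoneCSConj_single_iff]
  have hle : #(Z.Iset k) ≤ #(Z.Fset k) := by exact_mod_cast hK.k_le_g
  have h2 : (((#(Z.Fset k) - #(Z.Iset k) : ℕ) : ℝ)) ^ 2 ≤ ((#(Z.T1set k) * #(Z.T2set k) : ℕ) : ℝ) := by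
    rw [Nat.cast_sub hle]
    push_cast
    exact hK.cs
  exact_mod_cast h2

/-- Cone membership of the six-vector gives the ZONE O-CUBE. -/
theorem zoneOCubeConj_of_inCone_sixVec (h : InCone (Z.sixVec k)) : Z.ZoneOCubeConj {k} (∅ : Set V) :=
  zoneOCubeConj_of_zoneCS Z {k} ∅ (Z.zoneCSConj_of_inCone_sixVec k h)

end ZoneData

end ZoneZ

end PercRepro
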